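import Summits.Ventures.MM22.Rank234.RealizeCheck
import HarnessLib

/-!
# Cell pub-mm22 — realizability checker, part 2: vectors over `𝔽₂` in bits, folding, the duality certificate

Cell `pub-mm22` (MatrixMultiplication venture; seat engine-1 g9), topic `Summits/Ventures/MM22`.
HONEST FRAMING: checker PLUMBING (linear algebra over `𝔽₂` on bit-encoded vectors), not a bound and not a
result.  Contents: bit lemmas for `lval`/`kronBits`/`flatRow1`, injectivity of `ofBits`, the dot-product
functional `dotF` and spans `spanOf` of bit-encoded vectors (membership of subset-`xor`s, annihilation,
dimension bounds, echelon ⇒ independent), the folding identity `⟨y, lp ⊗ c⟩ = ⟨foldBits lp y, c⟩`, and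
`mem_allXors_of_dual`: a rank–nullity certificate (`E` with dual vectors `X`, kernel basis `Z`,
`|E| + |Z| = w`) proving that every vector annihilated by the rows is a subset-`xor` of `Z`.  No new facts.
-/

namespace Summit.Ventures.MM22.GF2Cert.Realize

open Summit.MatrixMultiplication.OmegaCensus.GF2RankLB
open Summit.Ventures.MM22.GF2Cert.Profile
open Literature.Computability.AlgebraicComplexity
open Module Matrix

/-! ### Bits -/

/-- A mask of an identically false predicate is `0`. -/
theorem maskOf_eq_zero_of_forall (f : ℕ → Bool) (hf : ∀ p, f p = false) : ∀ N, maskOf f N = 0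
  | 0 => rfl
  | N + 1 => by simp [maskOf, maskOf_eq_zero_of_forall f hf N, hf N]

/-- Bits of `lval`. -/
theorem testBit_lval (N : ℕ) (xs : List ℕ) (κ s : ℕ) (hs : s < xs.length) :
    (lval N xs κ).testBit s = bdot N κ (xs.getD s 0) := by
  simp [lval, testBit_maskOf, hs]

/-- Bits of `kronBits`. -/
theorem testBit_kronBits (w ℓ lp c t : ℕ) (ht : t < ℓ * w) :
    (kronBits w ℓ lp c).testBit t = (lp.testBit (t / w) && c.testBit (t % w)) := by
  simp [kronBits, testBit_maskOf, ht]

/-- `kronBits` with a zero factor vanishes (left). -/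
theorem kronBits_zero_left (w ℓ c : ℕ) : kronBits w ℓ 0 c = 0 :=
  maskOf_eq_zero_of_forall _ (fun p => by simp) _

/-- `kronBits` with a zero factor vanishes (right). -/
theorem kronBits_zero_right (w ℓ lp : ℕ) : kronBits w ℓ lp 0 = 0 :=
  maskOf_eq_zero_of_forall _ (fun p => by simp) _

/-- Bits of `flatRow1`. -/
theorem testBit_flatRow1 (l m n : ℕ) (xs : List ℕ) (b t : ℕ) (ht : t < xs.length * (l * n)) :
    (flatRow1 l m n xs b).testBit t = tbit m n (xs.getD (t / (l * n)) 0) b (t % (l * n)) := by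
  simp [flatRow1, testBit_maskOf, ht]

/-- `ofBits l n` is injective on patterns below `2 ^ (l n)`. -/
theorem ofBits_inj {l n x y : ℕ} (hx : x < 2 ^ (l * n)) (hy : y < 2 ^ (l * n))
    (h : ofBits l n x = ofBits l n y) : x = y := by
  apply Nat.eq_of_testBit_eq
  intro p
  by_cases hp : p < l * n
  · have hn : 0 < n := Nat.pos_of_ne_zero fun h0 => by subst h0; simp at hp
    have hi : p / n < l := (Nat.div_lt_iff_lt_mul hn).2 hp
    have hk : p % n < n := Nat.mod_lt _ hn
    have e := congrFun (congrFun h ⟨p / n, hi⟩) ⟨p % n, hk⟩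
    simp only [ofBits_apply, pos] at e
    have hpq : p % n + n * (p / n) = p := Nat.mod_add_div p n
    simp only [hpq] at e
    cases hxp : x.testBit p <;> cases hyp : y.testBit p <;> simp_all
  · rw [not_lt] at hp
    rw [Nat.testBit_lt_two_pow (lt_of_lt_of_le hx (Nat.pow_le_pow_right (by norm_num) hp)),
      Nat.testBit_lt_two_pow (lt_of_lt_of_le hy (Nat.pow_le_pow_right (by norm_num) hp))]

/-- `bitsOfMat` inverts `ofBits` below `2 ^ (l n)`. -/
theorem bitsOfMat_ofBits {l n z : ℕ} (hz : z < 2 ^ (l * n)) : bitsOfMat (ofBits l n z) = z :=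
  ofBits_inj (bitsOfMat_lt _) hz (ofBits_bitsOfMat _)

/-- Output coordinates in bits: `eC c w` is bit `c` of `bitsOfMat w`. -/
theorem eC_eq_testBit {l n : ℕ} (w : Matrix (Fin l) (Fin n) (ZMod 2)) (c : Fin (l * n)) :
    eC l n c w = if (bitsOfMat w).testBit c then 1 else 0 := by
  conv_lhs => rw [← ofBits_bitsOfMat w]
  simp only [eC, Matrix.entryLinearMap_apply, ofBits_apply, pos, Fin.coe_divNat, Fin.coe_modNat,
    Nat.mod_add_div]

/-! ### Vectors over `𝔽₂` encoded by naturals -/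

/-- The dot-product functional with pattern `y` on `Fin D → 𝔽₂`. -/
def dotF (D y : ℕ) : (Fin D → ZMod 2) →ₗ[ZMod 2] ZMod 2 :=
  ∑ p : Fin D, if y.testBit p then LinearMap.proj p else 0

/-- `dotF y (vecOf z) = [bdot y z]`. -/
theorem dotF_vecOf (D y z : ℕ) : dotF D y (vecOf D z) = if bdot D y z then 1 else 0 := by
  simp only [dotF, LinearMap.coe_sum, Finset.sum_apply]
  rw [bdot, ← sum_ite_range, ← Fin.sum_univ_eq_sum_range]
  refine Finset.sum_congr rfl fun p _ => ?_
  by_cases h : y.testBit p <;> simp [h, vecOf]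

/-- The span of the encoded vectors of a list. -/
def spanOf (D : ℕ) (G : List ℕ) : Submodule (ZMod 2) (Fin D → ZMod 2) :=
  Submodule.span (ZMod 2) {v | ∃ g ∈ G, v = vecOf D g}

/-- Listed vectors lie in `spanOf`. -/
theorem vecOf_mem_spanOf {D : ℕ} {G : List ℕ} {g : ℕ} (hg : g ∈ G) : vecOf D g ∈ spanOf D G :=
  Submodule.subset_span ⟨g, hg, rfl⟩

/-- `spanOf` is monotone in the list. -/
theorem spanOf_mono {D : ℕ} {G G' : List ℕ} (h : ∀ g ∈ G, g ∈ G') : spanOf D G ≤ spanOf D G' :=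
  Submodule.span_mono fun _ ⟨g, hg, hv⟩ => ⟨g, h g hg, hv⟩

/-- Subset-`xor`s lie in the span. -/
theorem vecOf_mem_spanOf_of_mem_allXors (D : ℕ) : ∀ (G : List ℕ) (s : ℕ), s ∈ allXors G →
    vecOf D s ∈ spanOf D G
  | [], s, hs => by
    simp only [allXors, List.mem_singleton] at hs
    subst hs
    rw [vecOf_zero]
    exact Submodule.zero_mem _
  | a :: G, s, hs => by
    simp only [allXors, List.mem_append, List.mem_map] at hs
    have hmono : spanOf D G ≤ spanOf D (a :: G) := spanOf_mono fun g hg => List.mem_cons_of_mem a hg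
    rcases hs with hs | ⟨s', hs', rfl⟩
    · exact hmono (vecOf_mem_spanOf_of_mem_allXors D G s hs)
    · rw [vecOf_xor]
      exact Submodule.add_mem _ (vecOf_mem_spanOf List.mem_cons_self)
        (hmono (vecOf_mem_spanOf_of_mem_allXors D G s' hs'))

/-- Selected `xor`s lie in the span. -/
theorem vecOf_xorSel_mem (D : ℕ) : ∀ (G : List ℕ) (mask : ℕ), vecOf D (xorSel G mask) ∈ spanOf D G
  | [], mask => by
    simp only [xorSel]
    rw [vecOf_zero]
    exact Submodule.zero_mem _
  | a :: G, mask => by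
    simp only [xorSel]
    have hmono : spanOf D G ≤ spanOf D (a :: G) := spanOf_mono fun g hg => List.mem_cons_of_mem a hg
    rw [vecOf_xor]
    refine Submodule.add_mem _ ?_ (hmono (vecOf_xorSel_mem D G (mask / 2)))
    split
    · exact vecOf_mem_spanOf List.mem_cons_self
    · rw [vecOf_zero]; exact Submodule.zero_mem _

/-- Annihilators of the listed vectors annihilate the span. -/
theorem dotF_eq_zero_of_mem_spanOf {D y : ℕ} {G : List ℕ} (hG : ∀ g ∈ G, bdot D y g = false)
    {v : Fin D → ZMod 2} (hv : v ∈ spanOf D G) : dotF D y v = 0 := by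
  have hle : spanOf D G ≤ LinearMap.ker (dotF D y) := by
    refine Submodule.span_le.2 ?_
    rintro v ⟨g, hg, rfl⟩
    simp [LinearMap.mem_ker, dotF_vecOf, hG g hg]
  exact LinearMap.mem_ker.1 (hle hv)

/-- `spanOf` has dimension at most the list length. -/
theorem finrank_spanOf_le (D : ℕ) (G : List ℕ) : finrank (ZMod 2) (spanOf D G) ≤ G.length := by
  classical
  have hset : {v : Fin D → ZMod 2 | ∃ g ∈ G, v = vecOf D g} = ↑((G.map (vecOf D)).toFinset) := by
    ext v
    simp only [Set.mem_setOf_eq, List.coe_toFinset, List.mem_map]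
    constructor
    · rintro ⟨g, hg, rfl⟩; exact ⟨g, hg, rfl⟩
    · rintro ⟨g, hg, rfl⟩; exact ⟨g, hg, rfl⟩
  unfold spanOf
  rw [hset]
  exact (finrank_span_finset_le_card _).trans ((List.toFinset_card_le _).trans (by simp))

/-- Echelon lists are independent in the sense of `indepB`. -/
theorem indepB_of_echelonB : ∀ (R : List ℕ), echelonB R = true → indepB R = true
  | [], _ => rfl
  | a :: R, h => by
    simp only [echelonB, Bool.and_eq_true, decide_eq_true_eq, List.all_eq_true] at h
    obtain ⟨⟨ha, hlt⟩, hR⟩ := h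
    simp only [indepB, Bool.and_eq_true, List.all_eq_true, Bool.not_eq_true', beq_eq_false_iff_ne, ne_eq]
    refine ⟨indepB_of_echelonB R hR, fun s hs hsa => ?_⟩
    have hs' : s < 2 ^ Nat.log2 a := allXors_lt R hlt s hs
    have ha' : 2 ^ Nat.log2 a ≤ a := Nat.log2_self_le (Nat.pos_iff_ne_zero.1 ha)
    omega

/-- An independent list inside a subspace bounds its dimension from below. -/
theorem length_le_finrank_of_echelon {D : ℕ} (R : List ℕ) (hE : echelonB R = true)
    (hlt : ∀ r ∈ R, r < 2 ^ D) (P : Submodule (ZMod 2) (Fin D → ZMod 2))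
    (hP : ∀ r ∈ R, vecOf D r ∈ P) : R.length ≤ finrank (ZMod 2) P := by
  have hind := linearIndependent_vecOf_of_indepB (N := D) (fun j : Fin R.length => R.get j)
    (fun j => hlt _ (List.get_mem R j)) (by rw [List.ofFn_get]; exact indepB_of_echelonB R hE)
  have h1 := finrank_span_eq_card hind
  rw [Fintype.card_fin] at h1
  have hle : Submodule.span (ZMod 2) (Set.range fun j : Fin R.length => vecOf D (R.get j)) ≤ P := by
    refine Submodule.span_le.2 ?_
    rintro v ⟨j, rfl⟩
    exact hP _ (List.get_mem R j)
  rw [← h1]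
  exact Submodule.finrank_mono hle

/-! ### Folding along a Kronecker factor, and the duality certificate -/

/-- Indicator of a Boolean in `𝔽₂`. -/
private theorem ite_and (a b : Bool) :
    (if (a && b) = true then (1 : ZMod 2) else 0) = (if a = true then 1 else 0) * (if b = true then 1 else 0) := by
  cases a <;> cases b <;> simp

/-- **Folding**: `⟨y, lp ⊗ c⟩ = ⟨foldBits lp y, c⟩` (as parities). -/
theorem bdot_kronBits (w ℓ lp c y : ℕ) :
    bdot (ℓ * w) y (kronBits w ℓ lp c) = bdot w (foldBits w ℓ lp y) c := by
  -- compare the indicators in `𝔽₂`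
  have key : (if bdot (ℓ * w) y (kronBits w ℓ lp c) = true then (1 : ZMod 2) else 0) =
      (if bdot w (foldBits w ℓ lp y) c = true then 1 else 0) := by
    rw [bdot, bdot, ← sum_ite_range, ← sum_ite_range]
    -- left: reindex `p = k + w s`
    rw [← sum_sum_eq_sum_range ℓ w (fun p => if (y.testBit p && (kronBits w ℓ lp c).testBit p) = true
      then (1 : ZMod 2) else 0)]
    rw [← Fin.sum_univ_eq_sum_range (fun k => if ((foldBits w ℓ lp y).testBit k && c.testBit k) = true
      then (1 : ZMod 2) else 0) w, Finset.sum_comm]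
    refine Finset.sum_congr rfl fun k _ => ?_
    have hw : 0 < w := Nat.pos_of_ne_zero fun h0 => by subst h0; exact absurd k.2 (by simp)
    have hfk : (foldBits w ℓ lp y).testBit k = bxor (fun s => lp.testBit s && y.testBit (k + w * s)) ℓ := by
      simp [foldBits, testBit_maskOf, k.2]
    rw [hfk, ite_and, ← sum_ite_range, ← Fin.sum_univ_eq_sum_range, Finset.sum_mul]
    refine Finset.sum_congr rfl fun s _ => ?_
    have hp : pos w s k < ℓ * w := by
      have := (finProdFinEquiv (s, k)).2; rwa [← pos_eq] at this
    have hdiv : pos w s k / w = s := by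
      simp only [pos]; rw [Nat.add_mul_div_left _ _ hw, Nat.div_eq_of_lt k.2, zero_add]
    have hmod : pos w s k % w = k := by
      simp only [pos]; rw [Nat.add_mul_mod_self_left, Nat.mod_eq_of_lt k.2]
    rw [testBit_kronBits _ _ _ _ _ hp, hdiv, hmod]
    simp only [pos]
    cases y.testBit (↑k + w * ↑s) <;> cases lp.testBit s <;> cases c.testBit k <;> simp
  revert key
  cases bdot (ℓ * w) y (kronBits w ℓ lp c) <;> cases bdot w (foldBits w ℓ lp y) c <;> simp

/-- `dotF` is additive in the pattern. -/
theorem dotF_xor (D a b : ℕ) : dotF D (a ^^^ b) = dotF D a + dotF D b := by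
  apply LinearMap.ext
  intro x
  simp only [dotF, LinearMap.coe_sum, Finset.sum_apply, LinearMap.add_apply, ← Finset.sum_add_distrib]
  refine Finset.sum_congr rfl fun p _ => ?_
  rw [Nat.testBit_xor]
  have h2 : x p + x p = 0 := by
    rw [← two_smul ℕ (x p)]
    have : ∀ a : ZMod 2, (2 : ℕ) • a = 0 := by decide
    exact this _
  cases a.testBit p <;> cases b.testBit p <;> simp [h2]

/-- `dotF` of the zero pattern vanishes. -/
theorem dotF_zero (D : ℕ) : dotF D 0 = 0 := by
  apply LinearMap.ext
  intro x
  simp [dotF]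

/-- A selected `xor` of rows that all annihilate `x` annihilates `x`. -/
theorem dotF_xorSel_eq_zero {D : ℕ} {x : Fin D → ZMod 2} : ∀ (rows : List ℕ) (mask : ℕ),
    (∀ r ∈ rows, dotF D r x = 0) → dotF D (xorSel rows mask) x = 0
  | [], mask, _ => by simp [xorSel, dotF_zero]
  | a :: rows, mask, h => by
    simp only [xorSel]
    rw [dotF_xor, LinearMap.add_apply,
      dotF_xorSel_eq_zero rows (mask / 2) (fun r hr => h r (List.mem_cons_of_mem a hr)), add_zero]
    split
    · exact h a List.mem_cons_self
    · simp [dotF_zero]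

/-- The span presentation used by `exists_allXors_of_mem_span`. -/
theorem spanOf_eq_span_rowVec (D : ℕ) (G : List ℕ) :
    spanOf D G = Submodule.span (ZMod 2) (Set.range (rowVec D G)) := by
  unfold spanOf
  congr 1
  ext v
  simp only [Set.mem_setOf_eq, Set.mem_range, rowVec]
  constructor
  · rintro ⟨g, hg, rfl⟩
    obtain ⟨i, hi⟩ := List.mem_iff_get.1 hg
    exact ⟨i, by rw [hi]⟩
  · rintro ⟨i, rfl⟩
    exact ⟨G.get i, List.get_mem G i, rfl⟩

/-- **The duality certificate**: if `E` (selected combinations of `rows`) has dual vectors `X`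
(`⟨E_j, X_i⟩ = δ_ij`), `Z` is an echelon list of kernel vectors of the rows, and `|E| + |Z| = w`, then every
`c < 2^w` annihilated by all rows is a subset-`xor` of `Z`. -/
theorem mem_allXors_of_dual {w : ℕ} (rows Esel X Z : List ℕ)
    (hlen : (Esel.map (xorSel rows)).length = X.length) (hδ : deltaB w (Esel.map (xorSel rows)) X = true)
    (hZlt : ∀ z ∈ Z, z < 2 ^ w) (hZe : echelonB Z = true)
    (hZk : ∀ z ∈ Z, ∀ r ∈ rows, bdot w r z = false)
    (hdim : (Esel.map (xorSel rows)).length + Z.length = w)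
    {c : ℕ} (hc : c < 2 ^ w) (hck : ∀ r ∈ rows, bdot w r c = false) : c ∈ allXors Z := by
  classical
  set E := Esel.map (xorSel rows) with hE
  let Φ : (Fin w → ZMod 2) →ₗ[ZMod 2] (Fin E.length → ZMod 2) :=
    LinearMap.pi fun j => dotF w (E.get j)
  -- rows-annihilated vectors are in `ker Φ`
  have hker : ∀ x : Fin w → ZMod 2, (∀ r ∈ rows, dotF w r x = 0) → x ∈ LinearMap.ker Φ := by
    intro x hx
    rw [LinearMap.mem_ker]
    funext j
    simp only [Φ, LinearMap.pi_apply, Pi.zero_apply]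
    have hj : E.get j = xorSel rows (Esel.get ⟨j, by simpa [hE] using j.2⟩) := by
      simp [hE, List.getElem_map]
    rw [hj]
    exact dotF_xorSel_eq_zero rows _ hx
  -- `Φ` is surjective (dual witnesses)
  have hδ' : ∀ (j : Fin E.length) (i : Fin X.length),
      bdot w (E.get j) (X.get i) = decide ((i : ℕ) = j) := by
    intro j i
    simp only [deltaB, List.all_eq_true, List.mem_range, beq_iff_eq] at hδ
    have := hδ j j.2 i i.2
    rwa [List.getD_eq_getElem _ _ j.2, List.getD_eq_getElem _ _ i.2, ← List.get_eq_getElem,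
      ← List.get_eq_getElem] at this
  have hsingle : ∀ i : Fin E.length,
      Φ (vecOf w (X.get ⟨i, hlen ▸ i.2⟩)) = Pi.single i 1 := by
    intro i
    funext j
    simp only [Φ, LinearMap.pi_apply, dotF_vecOf, hδ', Pi.single_apply]
    by_cases hij : j = i
    · subst hij; simp
    · have : ¬ ((i : ℕ) = j) := fun h => hij (Fin.ext h.symm)
      simp [hij, this]
  have hsurj : LinearMap.range Φ = ⊤ := by
    rw [LinearMap.range_eq_top]
    intro u
    refine ⟨∑ i, u i • vecOf w (X.get ⟨i, hlen ▸ i.2⟩), ?_⟩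
    simp only [map_sum, map_smul, hsingle]
    funext j
    simp [Finset.sum_apply, Pi.single_apply]
  -- rank–nullity
  have hrk := LinearMap.finrank_range_add_finrank_ker Φ
  rw [hsurj, finrank_top, Module.finrank_fin_fun, Module.finrank_fin_fun] at hrk
  -- `span Z = ker Φ`
  have hZle : spanOf w Z ≤ LinearMap.ker Φ := by
    refine Submodule.span_le.2 ?_
    rintro x ⟨z, hz, rfl⟩
    refine hker _ fun r hr => ?_
    simp [dotF_vecOf, hZk z hz r hr]
  have hZrank : Z.length ≤ finrank (ZMod 2) (spanOf w Z) :=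
    length_le_finrank_of_echelon Z hZe hZlt _ fun z hz => vecOf_mem_spanOf hz
  have hZup : finrank (ZMod 2) (spanOf w Z) ≤ finrank (ZMod 2) (LinearMap.ker Φ) := Submodule.finrank_mono hZle
  have heq : spanOf w Z = LinearMap.ker Φ := Submodule.eq_of_le_of_finrank_eq hZle (by omega)
  -- conclude
  have hcK : vecOf w c ∈ spanOf w Z := by
    rw [heq]
    refine hker _ fun r hr => ?_
    simp [dotF_vecOf, hck r hr]
  rw [spanOf_eq_span_rowVec] at hcK
  obtain ⟨s, hs, hcs⟩ := exists_allXors_of_mem_span w Z _ hcK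
  rwa [eq_of_vecOf_eq hc (allXors_lt Z hZlt s hs) hcs]

end Summit.Ventures.MM22.GF2Cert.Realize
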